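import Mathlib
import Summits.Ventures.PercRepro2.TwoHullMaster
import Summits.Ventures.PercRepro2.SwGlue

/-!
# The two-hull master statement across a cut at `l`, and its symmetry (blind cell PercRepro2,
night-4 g39, 2026-08-29; proofs/NIGHT4-G39.md §7)

(MM) of TwoHullMaster.lean survives gluing an ARBITRARY graph at `l`: if `l` is a cut vertex of
`G = G₁ ∪_l G₂` (`Glue.IsGluing ends₁ ends₂ l V₁ V₂`) with `h ∈ V₁ ∖ {l}`, then
`TwoHullMaster ends₁ l h → TwoHullMaster (glue ends₁ ends₂) l h` (**`twoHullMaster_glue_l`**).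
PROOF.  On `U` the hull of `h` stays on the first side, while the hull pair of `l` is the union of
its two side pairs (`cluster_glue_c`); so the two-hull count of the glued graph is
`Σ_{ζ₁ ∈ U₁, pair(h) ∈ 𝓦h} g(pair(l)(ζ₁))` with `g(q) = #{ζ₂ ∣ (q.1 ∪ A₂, q.2 ∪ B₂) ∈ 𝓦l}`, a
MONOTONE function of the pair `q`; writing `g = Σ_t 1[t < g]` (level sets), every level set
`{q ∣ t < g q}` is an up-set of pairs and (MM) on `G₁` bounds each term.  With the symmetry of
(MM) in `l ↔ h` (`twoHullMaster_symm`, by the swap identity) the same holds for a graph glued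
at `h`.  Hence (MM) on a graph follows from (MM) on the block between `l` and `h` after cutting
off everything hanging at `l` or at `h` — the (MM) analogue of the lane's cut-vertex reductions
`sw_glue_cut_l` / `sw_glue_cut_h` for (SW).

* `twoHullMaster_symm` — (MM) is symmetric in `l ↔ h`;
* `hull_glue_l_iff`, `hullPair_glue_h`, `hullPair_glue_l` — the pairs of the glued graph;
* `gluePairCount`, `gluePairCount_mono` — the fibre count and its monotonicity;
* **`twoHullMaster_glue_l`**, **`twoHullMaster_glue_h`**.
-/

namespace Summit.Ventures.PercRepro2

namespace Glue

open Hull LocRows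

open scoped Classical

variable {V : Type*} {E₁ E₂ : Type*}

/-! ## §1 Symmetry of (MM) in `l ↔ h` -/

section Symm

variable {E : Type*} [Fintype E] [DecidableEq E] {ends : E → Sym2 V}

omit [Fintype E] [DecidableEq E] in
/-- `h ∉ H_l` iff `l ∉ H_h`. -/
lemma notMem_hull_comm (ζ : Config E) (l h : V) :
    h ∉ hull ends ζ l ↔ l ∉ hull ends ζ h := by
  simp only [mem_hull_iff, not_or]
  constructor
  · rintro ⟨h1, h2⟩
    exact ⟨fun h' => h1 (conn_symm h'), fun h' => h2 (conn_symm h')⟩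
  · rintro ⟨h1, h2⟩
    exact ⟨fun h' => h1 (conn_symm h'), fun h' => h2 (conn_symm h')⟩

/-- The two-hull class with the roles of `l` and `h` exchanged. -/
lemma twoHullClass_comm (l h : V) (𝓦l 𝓦h : Set (Set V × Set V)) :
    twoHullClass ends h l 𝓦h 𝓦l = twoHullClass ends l h 𝓦l 𝓦h := by
  ext ζ
  rw [mem_twoHullClass, mem_twoHullClass, notMem_hull_comm]
  tauto

/-- **(MM) is symmetric in `l ↔ h`.** -/
theorem twoHullMaster_symm {l h : V} (hm : TwoHullMaster ends l h) : TwoHullMaster ends h l := by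
  intro 𝓦h 𝓦l h𝓦h h𝓦l
  rw [twoHullClass_comm l h 𝓦l 𝓦h, twoHullClass_comm l h (mirror 𝓦l) 𝓦h]
  have h1 := hm 𝓦l 𝓦h h𝓦l h𝓦h
  have h2 := card_twoHullClass_mirror_mirror (ends := ends) l h 𝓦l (mirror 𝓦h)
  rw [mirror_mirror] at h2
  omega

end Symm

/-! ## §2 The pairs of the glued graph -/

variable {ends₁ : E₁ → Sym2 V} {ends₂ : E₂ → Sym2 V} {l h : V} {V₁ V₂ : Set V}

/-- The hull of `l` in the glued graph contains `h ∈ V₁ ∖ {l}` iff the `G₁`-hull does. -/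
lemma hull_glue_l_iff (hg : IsGluing ends₁ ends₂ l V₁ V₂) (hh : h ∈ V₁) (hhl : h ≠ l)
    (ζ : Config (E₁ ⊕ E₂)) :
    h ∈ hull (glue ends₁ ends₂) ζ l ↔ h ∈ hull ends₁ (ζ ∘ Sum.inl) l := by
  have key : ∀ ω : Config (E₁ ⊕ E₂), h ∈ cluster (glue ends₁ ends₂) ω l ↔
      h ∈ cluster ends₁ (ω ∘ Sum.inl) l := by
    intro ω
    rw [cluster_glue_c hg]
    simp only [Set.mem_union]
    constructor
    · rintro (h' | h')
      · exact h'
      · exact absurd (hg.inter h hh (cluster_subset_of_mem₂ hg hg.c_mem₂ h')) hhl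
    · exact Or.inl
  simp only [mem_hull_iff, key, blue_comp_inl]

/-- On `U` the hull pair of `h` is its `G₁`-pair. -/
lemma hullPair_glue_h (hg : IsGluing ends₁ ends₂ l V₁ V₂) (hh : h ∈ V₁) {ζ : Config (E₁ ⊕ E₂)}
    (hU : h ∉ hull (glue ends₁ ends₂) ζ l) :
    hullPair (glue ends₁ ends₂) ζ h = hullPair ends₁ (ζ ∘ Sum.inl) h := by
  have key : ∀ ω : Config (E₁ ⊕ E₂), h ∉ cluster (glue ends₁ ends₂) ω l →
      cluster (glue ends₁ ends₂) ω h = cluster ends₁ (ω ∘ Sum.inl) h := by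
    intro ω hω
    rw [cluster_glue_eq hg hh]
    ext x
    simp only [Set.mem_union, Set.mem_setOf_eq]
    constructor
    · rintro (h' | ⟨hl, -⟩)
      · exact h'
      · exfalso
        apply hω
        rw [cluster_glue_c hg]
        exact Or.inl (conn_symm hl)
    · exact Or.inl
  simp only [mem_hull_iff, not_or] at hU
  simp only [hullPair, key ζ hU.1, key (blue ζ) hU.2, blue_comp_inl]

/-- The hull pair of `l` is the union of its side pairs. -/
lemma hullPair_glue_l (hg : IsGluing ends₁ ends₂ l V₁ V₂) (ζ : Config (E₁ ⊕ E₂)) :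
    hullPair (glue ends₁ ends₂) ζ l =
      ((hullPair ends₁ (ζ ∘ Sum.inl) l).1 ∪ (hullPair ends₂ (ζ ∘ Sum.inr) l).1,
        (hullPair ends₁ (ζ ∘ Sum.inl) l).2 ∪ (hullPair ends₂ (ζ ∘ Sum.inr) l).2) := by
  simp only [hullPair, cluster_glue_c hg, blue_comp_inl, blue_comp_inr]

/-! ## §3 The fibre count and the gluing theorem -/

variable [Fintype E₁] [Fintype E₂] [DecidableEq E₁] [DecidableEq E₂]

variable (ends₂) (l) in
/-- The number of second-side configurations whose pair, joined to `q`, lies in `𝓦`. -/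
noncomputable def gluePairCount (𝓦 : Set (Set V × Set V)) (q : Set V × Set V) : ℕ :=
  (Finset.univ.filter fun ζ₂ : Config E₂ =>
    (q.1 ∪ (hullPair ends₂ ζ₂ l).1, q.2 ∪ (hullPair ends₂ ζ₂ l).2) ∈ 𝓦).card

/-- The fibre count is monotone in the pair order. -/
lemma gluePairCount_mono {𝓦 : Set (Set V × Set V)} (h𝓦 : IsPairUpSet 𝓦) {q q' : Set V × Set V}
    (h1 : q.1 ⊆ q'.1) (h2 : q'.2 ⊆ q.2) :
    gluePairCount ends₂ l 𝓦 q ≤ gluePairCount ends₂ l 𝓦 q' := by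
  refine Finset.card_le_card fun ζ₂ hζ₂ => ?_
  simp only [Finset.mem_filter, Finset.mem_univ, true_and] at hζ₂ ⊢
  exact h𝓦 _ _ _ _ (Set.union_subset_union_left _ h1) (Set.union_subset_union_left _ h2) hζ₂

/-- The fibre count is at most the number of second-side configurations. -/
lemma gluePairCount_le (𝓦 : Set (Set V × Set V)) (q : Set V × Set V) :
    gluePairCount ends₂ l 𝓦 q ≤ Fintype.card (Config E₂) :=
  (Finset.card_le_card (Finset.filter_subset _ _)).trans (by simp)

/-- A level-set expansion of a bounded natural number. -/
lemma sum_range_boole_lt {m N : ℕ} (hm : m ≤ N) :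
    (∑ t ∈ Finset.range N, if t < m then (1 : ℕ) else 0) = m := by
  rw [Finset.sum_boole]
  have : (Finset.range N).filter (fun t => t < m) = Finset.range m := by
    ext t; simp only [Finset.mem_filter, Finset.mem_range]; omega
  simp [this]

/-- The two-hull count of the glued graph as a sum of fibre counts over the first side. -/
lemma card_twoHullClass_glue (hg : IsGluing ends₁ ends₂ l V₁ V₂) (hh : h ∈ V₁) (hhl : h ≠ l)
    (𝓦l 𝓦h : Set (Set V × Set V)) :
    (twoHullClass (glue ends₁ ends₂) l h 𝓦l 𝓦h).card =
      ∑ ζ₁ ∈ (Finset.univ.filter fun ζ₁ : Config E₁ =>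
          h ∉ hull ends₁ ζ₁ l ∧ hullPair ends₁ ζ₁ h ∈ 𝓦h),
        gluePairCount ends₂ l 𝓦l (hullPair ends₁ ζ₁ l) := by
  -- split the configurations of the glued graph into their sides
  rw [twoHullClass, Finset.card_filter]
  rw [← Fintype.sum_equiv (Equiv.sumArrowEquivProdArrow E₁ E₂ Bool).symm
    (fun x => if h ∉ hull (glue ends₁ ends₂) ((Equiv.sumArrowEquivProdArrow E₁ E₂ Bool).symm x) l ∧
      hullPair (glue ends₁ ends₂) ((Equiv.sumArrowEquivProdArrow E₁ E₂ Bool).symm x) l ∈ 𝓦l ∧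
      hullPair (glue ends₁ ends₂) ((Equiv.sumArrowEquivProdArrow E₁ E₂ Bool).symm x) h ∈ 𝓦h
      then 1 else 0) _ (fun x => rfl)]
  rw [Fintype.sum_prod_type, Finset.sum_filter]
  refine Finset.sum_congr rfl fun ζ₁ _ => ?_
  -- the inner sum
  have hside : ∀ ζ₂ : Config E₂,
      (Equiv.sumArrowEquivProdArrow E₁ E₂ Bool).symm (ζ₁, ζ₂) = pair ζ₁ ζ₂ := fun ζ₂ => rfl
  simp only [hside]
  by_cases hU : h ∉ hull ends₁ ζ₁ l
  · by_cases hW : hullPair ends₁ ζ₁ h ∈ 𝓦h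
    · simp only [hU, hW]
      rw [gluePairCount, Finset.card_filter]
      refine Finset.sum_congr rfl fun ζ₂ _ => ?_
      have hU' : h ∉ hull (glue ends₁ ends₂) (pair ζ₁ ζ₂) l := by
        rw [hull_glue_l_iff hg hh hhl, pair_inl]; exact hU
      rw [hullPair_glue_h hg hh hU', hullPair_glue_l hg, pair_inl, pair_inr]
      simp only [hU', hW, not_false_eq_true, true_and, and_true]
    · simp only [hW, and_false, if_false]
      refine Finset.sum_eq_zero fun ζ₂ _ => ?_
      have hU' : h ∉ hull (glue ends₁ ends₂) (pair ζ₁ ζ₂) l := by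
        rw [hull_glue_l_iff hg hh hhl, pair_inl]; exact hU
      rw [hullPair_glue_h hg hh hU', pair_inl]
      simp only [hW, and_false, if_false]
  · simp only [hU, false_and, if_false]
    refine Finset.sum_eq_zero fun ζ₂ _ => ?_
    have hU' : ¬ h ∉ hull (glue ends₁ ends₂) (pair ζ₁ ζ₂) l := by
      rw [hull_glue_l_iff hg hh hhl, pair_inl]; exact hU
    simp only [hU', false_and, if_false]

/-- **(MM) across a cut at `l`**: (MM) on the first side gives (MM) on the graph glued at `l`. -/
theorem twoHullMaster_glue_l (hg : IsGluing ends₁ ends₂ l V₁ V₂) (hh : h ∈ V₁) (hhl : h ≠ l)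
    (hm : TwoHullMaster ends₁ l h) : TwoHullMaster (glue ends₁ ends₂) l h := by
  intro 𝓦l 𝓦h h𝓦l h𝓦h
  rw [card_twoHullClass_glue hg hh hhl, card_twoHullClass_glue hg hh hhl]
  set N := Fintype.card (Config E₂)
  -- level sets of the fibre count
  have expand : ∀ S : Finset (Config E₁),
      ∑ ζ₁ ∈ S, gluePairCount ends₂ l 𝓦l (hullPair ends₁ ζ₁ l) =
        ∑ t ∈ Finset.range N, (S.filter fun ζ₁ =>
          t < gluePairCount ends₂ l 𝓦l (hullPair ends₁ ζ₁ l)).card := by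
    intro S
    simp_rw [Finset.card_filter]
    rw [Finset.sum_comm]
    refine Finset.sum_congr rfl fun ζ₁ _ => ?_
    rw [sum_range_boole_lt (gluePairCount_le _ _)]
  rw [expand, expand]
  refine Finset.sum_le_sum fun t _ => ?_
  -- each level set is an up-set of pairs
  let 𝓦t : Set (Set V × Set V) := {q | t < gluePairCount ends₂ l 𝓦l q}
  have h𝓦t : IsPairUpSet 𝓦t := by
    intro A A' B B' hA hB hAB
    exact lt_of_lt_of_le hAB (gluePairCount_mono h𝓦l hA hB)
  have e : ∀ 𝓦 : Set (Set V × Set V),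
      ((Finset.univ.filter fun ζ₁ : Config E₁ => h ∉ hull ends₁ ζ₁ l ∧ hullPair ends₁ ζ₁ h ∈ 𝓦).filter
        fun ζ₁ => t < gluePairCount ends₂ l 𝓦l (hullPair ends₁ ζ₁ l)) =
        twoHullClass ends₁ l h 𝓦t 𝓦 := by
    intro 𝓦
    ext ζ₁
    simp only [Finset.mem_filter, Finset.mem_univ, true_and, mem_twoHullClass, 𝓦t, Set.mem_setOf_eq]
    tauto
  rw [e, e]
  exact hm 𝓦t 𝓦h h𝓦t h𝓦h

/-- **(MM) across a cut at `h`**: by the symmetry of (MM). -/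
theorem twoHullMaster_glue_h (hg : IsGluing ends₁ ends₂ h V₁ V₂) (hl : l ∈ V₁) (hlh : l ≠ h)
    (hm : TwoHullMaster ends₁ l h) : TwoHullMaster (glue ends₁ ends₂) l h :=
  twoHullMaster_symm (twoHullMaster_glue_l hg hl hlh (twoHullMaster_symm hm))

end Glue

end Summit.Ventures.PercRepro2
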